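import Mathlib.Probability.Process.LocalProperty
import Mathlib.Probability.Martingale.Basic
import Mathlib.Probability.Process.Stopping
import Mathlib.Probability.Process.Adapted
import Mathlib.Probability.Process.Filtration
import Literature.Probability.Process.BrownianMotion
import HarnessLib

-- provenance: harness21/H21/H21/Prelude/Stoch/LocalMartingale.lean @ ecd7fd8 (interim HEAD d8f2665); M5 mechanical rewrite
/-!
# Local martingales and the Brownian filtration (Stoch trunk, prelude C3)

This small file provides what the target statement **crit-perc.S22** (Cardy's observable is a
local martingale iff `κ = 6`) needs on top of the canonical Brownian motion `Literature.Probability.Process.brownian`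
(prelude C2, `Literature.Prelude.Stoch.BrownianMotion`):

* `Literature.IsLocalMartingale X 𝓕 P`: a real process indexed by `ℝ≥0` is a *local martingale* if it
  is *locally* a martingale, in the sense of Mathlib's `ProbabilityTheory.Locally`
  (`Mathlib/Probability/Process/LocalProperty.lean`): there is a localizing sequence of stopping
  times `τₙ ↑ ∞` a.s. such that each stopped process `(𝟙_{0 < τₙ} X)^{τₙ}` (Mathlib's convention:
  the indicator of `{⊥ < τₙ}`) is a martingale (Mathlib's `MeasureTheory.Martingale`);
* `Literature.Probability.RandomPlanarGeometry.brownianFiltration`: the natural filtration of `Literature.Probability.Process.brownian` (Mathlib's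
  `MeasureTheory.Filtration.natural`), and adaptedness of `brownian` to it (proved from
  Mathlib's `Filtration.stronglyAdapted_natural`);
* the classical martingale facts (sorried, cited): `brownian` is a martingale, hence a local
  martingale, and `brownian t ^ 2 - t` is a martingale.

## Mathlib status

Mathlib (pinned commit) has filtrations, (strongly) adapted processes, stopping times, stopped
processes, martingales and the general `Locally p 𝓕 X P` combinator with its API
(`Locally.of_prop`, `Locally.mono`, `IsStable.locally_locally_iff`, …), but no named notion of
local martingale and no martingale facts about Brownian motion. We therefore only *name* the
specialisation `Locally (Martingale · 𝓕 P)`; all structural API is Mathlib's.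

## References

* D. Revuz, M. Yor, *Continuous Martingales and Brownian Motion* (3rd ed., 1999), Ch. II §2
  (Brownian martingales), Ch. IV §1 (local martingales).
* O. Kallenberg, *Foundations of Modern Probability* (2nd ed., 2002), Ch. 17.
-/

open MeasureTheory ProbabilityTheory
open scoped NNReal

namespace Literature.Probability.RandomPlanarGeometry

/-! ### Local martingales -/

section LocalMartingale

variable {Ω : Type*} {m : MeasurableSpace Ω}

/-- A real-valued process `X : ℝ≥0 → Ω → ℝ` is a **local martingale** with respect to the
filtration `𝓕` and the measure `P` if it is *locally* a martingale: there exists a localizing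
sequence `(τₙ)` of `𝓕`-stopping times (`τₙ ↑ ∞` a.s.) such that every stopped process
`(𝟙_{⊥ < τₙ} X)^{τₙ}` is an `𝓕`-martingale under `P`. This is Mathlib's
`ProbabilityTheory.Locally` applied to the predicate `MeasureTheory.Martingale · 𝓕 P`.
Revuz–Yor, *Continuous Martingales and Brownian Motion* (1999), Ch. IV, Def. 1.5;
Kallenberg, *Foundations* (2002), Ch. 17. [folklore] -/
def IsLocalMartingale (X : ℝ≥0 → Ω → ℝ) (𝓕 : Filtration ℝ≥0 m) (P : Measure Ω) : Prop :=
  ProbabilityTheory.Locally (fun Y ↦ Martingale Y 𝓕 P) 𝓕 X P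

variable {X : ℝ≥0 → Ω → ℝ} {𝓕 : Filtration ℝ≥0 m} {P : Measure Ω}

/-- Every martingale is a local martingale (take the constant localizing sequence `τₙ = ∞`;
Mathlib's `ProbabilityTheory.Locally.of_prop`).
Revuz–Yor, *Continuous Martingales and Brownian Motion* (1999), Ch. IV, remark after
Def. 1.5. [folklore] -/
theorem _root_.MeasureTheory.Martingale.isLocalMartingale (h : Martingale X 𝓕 P) :
    IsLocalMartingale X 𝓕 P :=
  Locally.of_prop h

/-- A local martingale admits a localizing sequence along which the stopped (indicator)
processes are martingales (unfolding of the definition; Mathlib's `Locally.localSeq`).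
Revuz–Yor, *Continuous Martingales and Brownian Motion* (1999), Ch. IV, Def. 1.5. [folklore] -/
theorem IsLocalMartingale.exists_isLocalizingSequence (h : IsLocalMartingale X 𝓕 P) :
    ∃ τ : ℕ → Ω → WithTop ℝ≥0, IsLocalizingSequence 𝓕 τ P ∧
      ∀ n, Martingale (stoppedProcess (fun i ↦ {ω | ⊥ < τ n ω}.indicator (X i)) (τ n)) 𝓕 P :=
  h

end LocalMartingale

/-! ### The Brownian filtration -/

/-- The **Brownian filtration** on the canonical space `ℝ≥0 → ℝ`: the natural filtration
`𝓕ᵂ_t = σ(brownian s : s ≤ t)` generated by the canonical Brownian motion `Literature.Probability.Process.brownian`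
(Mathlib's `MeasureTheory.Filtration.natural`; not completed, not made right-continuous).
Revuz–Yor, *Continuous Martingales and Brownian Motion* (1999), Ch. I §4 and Ch. II §2. [folklore] -/
noncomputable def brownianFiltration :
    Filtration ℝ≥0 (inferInstance : MeasurableSpace (ℝ≥0 → ℝ)) :=
  Filtration.natural (β := fun _ ↦ ℝ) (fun t ↦ Process.brownian t) fun t ↦ Process.stronglyMeasurable_brownian t

/-- The canonical Brownian motion is strongly adapted to its natural filtration (Mathlib's
`Filtration.stronglyAdapted_natural`).
Revuz–Yor, *Continuous Martingales and Brownian Motion* (1999), Ch. I §4. [folklore] -/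
theorem stronglyAdapted_brownian : StronglyAdapted brownianFiltration Process.brownian :=
  Filtration.stronglyAdapted_natural (β := fun _ ↦ ℝ) fun t ↦ Process.stronglyMeasurable_brownian t

/-- The canonical Brownian motion is adapted to its natural filtration.
Revuz–Yor, *Continuous Martingales and Brownian Motion* (1999), Ch. I §4. [folklore] -/
theorem adapted_brownian : Adapted brownianFiltration Process.brownian :=
  stronglyAdapted_brownian.adapted

/-! ### Brownian martingales -/

/-- **Brownian motion is a martingale** with respect to its natural filtration under the
pre-Wiener measure: `E[B_t | 𝓕ᵂ_s] = B_s` for `s ≤ t` (independent centred increments).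
Revuz–Yor, *Continuous Martingales and Brownian Motion* (1999), Ch. II, Prop. (1.2)(i);
Kallenberg, *Foundations* (2002), Ch. 13 and Ch. 17. [cite: RevuzYor1999, Ch. II Prop. (1.2)(i)] -/
def martingale_brownian : Prop :=
  Martingale Process.brownian brownianFiltration Process.preWienerMeasure

/-- Brownian motion is a local martingale with respect to its natural filtration (corollary of
the fact `Literature.Probability.RandomPlanarGeometry.martingale_brownian`, taken as the hypothesis `h`).
Revuz–Yor, *Continuous Martingales and Brownian Motion* (1999), Ch. IV §1. [folklore] -/
theorem isLocalMartingale_brownian (h : martingale_brownian) :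
    IsLocalMartingale Process.brownian brownianFiltration Process.preWienerMeasure :=
  Martingale.isLocalMartingale h

/-- **`B_t² - t` is a martingale** with respect to the Brownian filtration under the pre-Wiener
measure (the quadratic variation of Brownian motion is `t`).
Revuz–Yor, *Continuous Martingales and Brownian Motion* (1999), Ch. II, Prop. (1.2)(ii);
Kallenberg, *Foundations* (2002), Ch. 13 and Ch. 17. [cite: RevuzYor1999, Ch. II Prop. (1.2)(ii)] -/
def martingale_brownian_sq_sub : Prop :=
  Martingale (fun t ω ↦ Process.brownian t ω ^ 2 - (t : ℝ)) brownianFiltration Process.preWienerMeasure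

end Literature.Probability.RandomPlanarGeometry
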